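import Mathlib.RingTheory.Polynomial.Resultant.Basic
import Mathlib.RingTheory.AdjoinRoot
import Mathlib.Algebra.Polynomial.Taylor
import Mathlib.Algebra.Polynomial.HasseDeriv
import Mathlib.Algebra.MvPolynomial.Eval
import Mathlib.Algebra.Polynomial.Roots
import HarnessLib

/-!
# Kaltofen's absolute irreducibility test — the objects (definitions only)

E. Kaltofen, *Effective Noether irreducibility forms and applications*, J. Comput. System Sci.
50 (1995) 274–295 [`Kaltofen1995`], §2 ("Algorithm Absolute Irreducibility Test") and §3
(generic inputs, the linear system (29), Thm. 4), read in the held copy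
(`lit read doi:10.1006/jcss.1995.1023`, pp. 8–9 of the text = §2, pp. 10–17 = §3).

This file introduces, for a commutative ring `A` and `P ∈ A[y][x]` (outer variable `x`, the one
solved for; inner variable `y`, the series variable — the convention of the tree's
`BertiniNewtonProofs`), the division-free versions of the objects of Kaltofen's test, and for the
generic polynomial over `ℤ[c]` his integer forms `Δ`. All statements about them (the scaled
Newton identity, the root property, the linear system, functoriality, and the correctness of the
test over every field) are proved in the sibling files `KaltofenScaledNewtonProofs`,
`KaltofenTestMatrixProofs`, `KaltofenTestSoundnessProofs`, `KaltofenTestCorrectnessProofs`.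
No named facts; Mathlib only (plus `HarnessLib`).

## The objects (Kaltofen's notation in quotes)

* `red P = P(x, 0)` ("`f(x,0)`"), `Rt P = A[z]/(P(z,0))` ("`R := K[z]/(f(z,0))`"), `zbar`
  ("`α₀ ← z mod f(z,0)`"), `rres P d = Res_x(P(x,0), ∂ₓP(x,0))` with formal degrees `d, d-1`
  ("`ρ`", eq. (12)), `cofPoly`/`cof` the cofactor `t` with `t·∂ₓP(x,0) ≡ ρ (mod P(x,0))`, read off
  Mathlib's `adjSylvester` (so that it is canonical, hence functorial), ("`ρ β₀ = t(z)`").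
* THE NORMALISATION (design choice, replacing Kaltofen's Hensel/Cramer recursion (10) and his a
  posteriori statement (18) "`ρ^{2k-1} a_k ∈ D[z]/(f₀(z))`"): substituting `y = ρ²Y`,
  `x = z̄ + ρu` turns `P` into `ρ P₀'(z̄) · F♮(u, Y)` with `F♮ = u + r·G(u,Y)` (`natF`, `bigG`,
  built from the Taylor data `tayl`), a polynomial with `F♮(0,0) = 0`, `∂ᵤF♮(0,0) = 1` over ANY
  ring; its Newton iterates `newtonSeq`/`deltaBar` never divide, and `alphaSharp = z̄ + ρ δ̄` is
  the scaled approximate root; `[Y^k] δ̄ = ρ^{2k-1} a_k` is Kaltofen's `ā_k`.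
* `powA` — Kaltofen's recursion (27) for the powers: `(z̄ + ρδ̄)ⁱ = z̄ⁱ + ρ A_i`;
  `entryR`, `kMatrix` — the entries of the linear system (29) and their `z̄ʲ`-coordinates
  (rows `(k, j)`, `k ≤ ℓ`; columns `(i, l, ι)`: unknown `u_{i,l,ι}` = coefficient of
  `xⁱ yˡ z̄^ι` of the candidate factor); `smallPoly w` the candidate factor `h_w` (eq. (5));
  `unscaleY`, `alphaTrue` — back to the true variable over a field (`ρ ≠ 0`);
  `mapP`, `spec` — base change; `evRoot` — evaluation `K[z]/(P₀) → L` at a root; `coords` — the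
  coordinate vector of a small polynomial.
* `GenCoeff = ℤ[c_{e₁,e₂}]`, `genPoly d = x^d + Σ_{e₁<d, e₁+e₂≤d} c_{e₁,e₂} x^{e₁}y^{e₂}` ("`f`",
  §3), `specialize`, `coeffVec`, and `genMinor d S` — the maximal minors `Δ` of the generic
  matrix (unknown `y`-degree `≤ d`, precision `ℓ = (2d-1)d`, root precision `2ℓ+1`), the integer
  forms of Thm. 4 / Thm. 7.

## Deliberately NOT here

Degree and norm bounds (Thm. 1, 2, 4: `deg Δ ≤ 12d⁶ - 2d⁵ - 10d⁴ + 4d³`, `‖Δ‖₁ ≤ (2d)^{34d⁶}`), the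
generic substitution of §4–5 and the assembly of Thm. 7, Thm. 8 (see `KaltofenNoetherForms`,
`KaltofenOstrowskiProofs`, `KaltofenNoetherFormsProofs`, `KaltofenNoetherFormsHenselProofs`).

## References

* E. Kaltofen, J. Comput. System Sci. 50 (1995) 274–295, §2–3. [Kaltofen1995]
* E. Kaltofen, *Fast parallel absolute irreducibility testing*, J. Symbolic Comput. 1 (1985)
  57–67 (the test; cited through [Kaltofen1995]).
-/

noncomputable section

open Polynomial

namespace Literature.RingTheory.MvPolynomial.KaltofenAIT

universe u v

variable {A : Type u} [CommRing A]

/-! ### `R = A[z]/(P(z,0))`, `ρ`, `r` -/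

/-- `P(x, 0) ∈ A[x]`: the reduction modulo `y` of `P ∈ A[y][x]` (outer variable `x`, inner `y`).
[cite: Kaltofen1995, §2 ("f(x, 0)")] -/
abbrev red (P : Polynomial A[X]) : A[X] := P.map (evalRingHom 0)

/-- Kaltofen's ring `R = A[z]/(P(z, 0))` in which all roots of `P(x, 0)` live at once
("Step N: Let `R := K[z]/(f(z, 0))`"). [cite: Kaltofen1995, §2, Algorithm Absolute Irreducibility Test] -/
abbrev Rt (P : Polynomial A[X]) : Type u := AdjoinRoot (red P)

/-- `z̄ = z mod P(z, 0)`, the universal root ("`α₀ ← z mod f(z, 0) ∈ R`"). [cite: Kaltofen1995, §2] -/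
abbrev zbar (P : Polynomial A[X]) : Rt P := AdjoinRoot.root (red P)

/-- `ρ = Res_x(P(x,0), ∂P(x,0)/∂x)` with formal degrees `d, d - 1`. [cite: Kaltofen1995, §2 eq. (12)] -/
def rres (P : Polynomial A[X]) (d : ℕ) : A :=
  resultant (red P) (derivative (red P)) d (d - 1)

/-- `1` has degree `< m + n` as soon as `m ≠ 0`. [folklore] -/
theorem one_mem_degreeLT {m n : ℕ} (h : m ≠ 0) : (1 : A[X]) ∈ degreeLT A (m + n) := by
  nontriviality A
  rw [mem_degreeLT, degree_one]
  have h' : 0 < m + n := by omega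
  exact_mod_cast h'

/-- The cofactor `t(x) ∈ A[x]` of the Euclidean scheme `s(x) P(x,0) + t(x) ∂P(x,0)/∂x = ρ`
(degree `< d`), read off the adjugate of the Sylvester matrix. [cite: Kaltofen1995, §2 eq. (12)] -/
def cofPoly (P : Polynomial A[X]) (d : ℕ) : A[X] :=
  if h : d = 0 then 0 else
    ((adjSylvester (m := d) (n := d - 1) (red P) (derivative (red P))
      ⟨1, one_mem_degreeLT h⟩).1 : A[X])

/-- `r = t(z̄) ∈ R`, Kaltofen's `ρ β₀ = t(z) mod f(z,0)`: it satisfies `r · P₀'(z̄) = ρ`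
(`cof_mul_derivative`). [cite: Kaltofen1995, §2, Algorithm Absolute Irreducibility Test, Step N] -/
def cof (P : Polynomial A[X]) (d : ℕ) : Rt P :=
  AdjoinRoot.mk (red P) (cofPoly P d)

/-! ### Taylor data, the scaled Newton polynomial, the scaled root -/

section Objects

variable (P : Polynomial A[X]) (d e : ℕ)

/-- `P` read in `R[y][x]`. [folklore] -/
abbrev liftR : Polynomial (Rt P)[X] := P.map (mapRingHom (algebraMap A (Rt P)))

/-- `ρ ∈ R`. [folklore] -/
abbrev rhoR : Rt P := algebraMap A (Rt P) (rres P d)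

/-- `P₀'(z̄) ∈ R` (the value of `∂P(x,0)/∂x` at the universal root). [folklore] -/
abbrev der0 : Rt P := AdjoinRoot.mk (red P) (derivative (red P))

/-- Kaltofen's Taylor data `T_i(y) = (1/i!) ∂ⁱP/∂xⁱ (z̄, y) ∈ R[y]`; its `y^j`-coefficient is the
quantity `F_{j,i}` multiplying `aⁱ` in the `yʲ`-part of `f(α, y)`.
[cite: Kaltofen1995, §3 (proof of Thm. 2)] -/
def tayl (i : ℕ) : (Rt P)[X] := (hasseDeriv i (liftR P)).eval (C (zbar P))

/-- The scaled remainder `G(u, Y) = Σ_{(i,j) ≠ (0,0),(1,0)} F_{j,i} ρ^{i+2j-2} uⁱ Yʲ ∈ R[Y][u]` of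
the substitution `x = z̄ + ρu`, `y = ρ²Y` into `P`. [cite: Kaltofen1995, §2–3 (Newton iteration, normalised)] -/
def bigG : Polynomial (Rt P)[X] :=
  ∑ i ∈ Finset.range (d + 1), ∑ j ∈ Finset.range (e + 1),
    if (i = 0 ∧ j = 0) ∨ (i = 1 ∧ j = 0) then 0
    else C (C ((tayl P i).coeff j * rhoR P d ^ (i + 2 * j - 2)) * X ^ j) * X ^ i

/-- The scaled Newton polynomial `F♮(u, Y) = u + r G(u, Y)`: `F♮(0, 0) = 0` and
`∂F♮/∂u (0, 0) = 1`, so Newton iteration applies over ANY coefficient ring, without division.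
[cite: Kaltofen1995, §2, Algorithm Absolute Irreducibility Test, Step N] -/
def natF : Polynomial (Rt P)[X] := X + C (C (cof P d)) * bigG P d e

/-- The `y`-scaling `p(y) ↦ p(ρ² y)` on `R[y]`. [folklore] -/
abbrev scaleY : (Rt P)[X] →+* (Rt P)[X] := compRingHom (C (rhoR P d ^ 2) * X)

/-- `P♯(x, Y) = P(x, ρ²Y) ∈ R[Y][x]`. [folklore] -/
def sharpP : Polynomial (Rt P)[X] := (liftR P).map (scaleY P d)

/-- `P̃(u, Y) = P(z̄ + ρu, ρ²Y) ∈ R[Y][u]`. [folklore] -/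
def tildeP : Polynomial (Rt P)[X] :=
  (sharpP P d).comp (C (C (zbar P)) + C (C (rhoR P d)) * X)

end Objects

section Newton

variable {B : Type v} [CommRing B]

/-- The simplified Newton iterates `a₀ = 0`, `a_{k+1} = a_k - χ(a_k)` for `χ ∈ B[Y][u]` with
`χ(0) ≡ 0`, `∂χ/∂u(0) ≡ 1 (mod Y)` (an explicit, hence functorial, version of the tree's
`exists_approxRoot`). [cite: Kaltofen1995, §2 Step N (Newton iteration)] -/
def newtonSeq (χ : Polynomial B[X]) : ℕ → B[X]
  | 0 => 0
  | k + 1 => newtonSeq χ k - χ.eval (newtonSeq χ k)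

end Newton

section Root

variable (P : Polynomial A[X]) (d e K : ℕ)

/-- Kaltofen's truncated, `ρ`-normalised root increment `δ̄_K ∈ R[Y]`: the `K`-th Newton iterate
for `F♮`. With `y = ρ²Y`, `α = z̄ + ρ δ̄(Y)` is the approximate root of `P` and the
`Y^k`-coefficient of `δ̄` is `ρ^{2k-1} a_k` ("`ā_k`", eq. (18)). [cite: Kaltofen1995, §3 Thm. 1] -/
def deltaBar : (Rt P)[X] := newtonSeq (natF P d e) K

/-- The scaled approximate root `α♯_K = z̄ + ρ δ̄_K ∈ R[Y]`. [cite: Kaltofen1995, §2 ("`α ∈ R[y]`")] -/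
def alphaSharp : (Rt P)[X] := C (zbar P) + C (rhoR P d) * deltaBar P d e K

/-- `A_i = ((z̄ + ρδ̄)ⁱ - z̄ⁱ)/ρ ∈ R[Y]`, computed without division by Kaltofen's recursion (27):
`A_0 = 0`, `A_{i+1} = z̄ A_i + z̄ⁱ δ̄ + ρ δ̄ A_i`; its `Y^k`-coefficient is `ρ^{2k-1} a^{(i)}_k`
("`ā^{(i)}_k`"). [cite: Kaltofen1995, §3 Thm. 2, eq. (27)] -/
def powA : ℕ → (Rt P)[X]
  | 0 => 0
  | i + 1 => C (zbar P) * powA i + C (zbar P ^ i) * deltaBar P d e K +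
      C (rhoR P d) * deltaBar P d e K * powA i

/-- The `R`-valued entries of Kaltofen's linear system (29), row `k` (the `Y^k`-coefficient),
column `(i, l, ι)` (the unknown `u_{i,l,ι}`, coefficient of `xⁱ yˡ z̄^ι` of the candidate factor):
`ρ^{2l} ā^{(i)}_{k-l} z̄^ι` for `l < k`, `ρ^{2k-1} z̄^{i+ι}` for `l = k`, `0` for `l > k`.
[cite: Kaltofen1995, §3 eq. (29)] -/
def entryR (k : ℕ) (c : ℕ × ℕ × ℕ) : Rt P :=
  if c.2.1 < k then rhoR P d ^ (2 * c.2.1) * (powA P d e K c.1).coeff (k - c.2.1) * zbar P ^ c.2.2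
  else if c.2.1 = k then rhoR P d ^ (2 * k - 1) * zbar P ^ (c.1 + c.2.2) else 0

/-- Kaltofen's matrix (29) over the coefficient ring `A`: the `z̄ʲ`-coordinates (`j < d`, power
basis of `R = A[z]/(P(z,0))`, `P(z, 0)` monic of degree `d`) of the entries `entryR`; rows
`(k, j)` with `k ≤ ℓ`, columns `(i, l, ι)` with `i < d`, `l ≤ e`, `ι < d`
(`N = d²(e+1)` unknowns). Its maximal minors are the Noether-form ingredients `Δ` of Thm. 4.
[cite: Kaltofen1995, §3 eq. (29), Thm. 4] -/
def kMatrix (hm : (red P).Monic) (ℓ : ℕ) :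
    Matrix (Fin (ℓ + 1) × Fin d) (Fin d × Fin (e + 1) × Fin d) A :=
  fun r c => (AdjoinRoot.modByMonicHom hm
    (entryR P d e K r.1 ((c.1 : ℕ), (c.2.1 : ℕ), (c.2.2 : ℕ)))).coeff r.2

/-- The candidate factor `h_w = Σ_{i,l,ι} w_{i,l,ι} z̄^ι yˡ xⁱ ∈ R[y][x]` attached to a vector of
unknowns `w` ("`Σ hᵢ(y) αⁱ`", eq. (5)). [cite: Kaltofen1995, §2 eq. (5)–(6)] -/
def smallPoly (w : Fin d × Fin (e + 1) × Fin d → A) : Polynomial (Rt P)[X] :=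
  ∑ c, C (C (algebraMap A (Rt P) (w c) * zbar P ^ (c.2.2 : ℕ)) * X ^ (c.2.1 : ℕ)) * X ^ (c.1 : ℕ)

end Root

/-! ### Over a field: the true variable `y = ρ² Y` -/

section FieldScale

variable {K : Type u} [Field K] (P : Polynomial K[X]) (d e K' : ℕ)

/-- The inverse scaling `p(Y) ↦ p(ρ⁻² y)` (over a field, `ρ ≠ 0`). [folklore] -/
abbrev unscaleY : (Rt P)[X] →+* (Rt P)[X] :=
  compRingHom (C (algebraMap K (Rt P) ((rres P d)⁻¹ ^ 2)) * X)

/-- The approximate root in the true variable: `α_K(y) = z̄ + ρ δ̄_K(y/ρ²) ∈ R[y]`.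
[cite: Kaltofen1995, §2 Step N ("`α ∈ R[y]`")] -/
def alphaTrue : (Rt P)[X] := unscaleY P d (alphaSharp P d e K')

/-- The coordinate vector of a small `H ∈ R[y][x]`: `w_{i,l,ι} = ` the `z̄^ι`-coordinate of the
`xⁱ yˡ`-coefficient. [folklore] -/
def coords (hm : (red P).Monic) (e : ℕ) (H : Polynomial (Rt P)[X]) :
    Fin d × Fin (e + 1) × Fin d → K :=
  fun c => (AdjoinRoot.modByMonicHom hm ((H.coeff c.1).coeff c.2.1)).coeff c.2.2

end FieldScale

/-! ### Base change -/

section Functorial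

variable {B : Type v} [CommRing B] (φ : A →+* B) (P : Polynomial A[X])

/-- Base change of `P ∈ A[y][x]` along `φ`. [folklore] -/
abbrev mapP : Polynomial B[X] := P.map (mapRingHom φ)

/-- `red` commutes with base change. [folklore] -/
theorem red_mapP : red (mapP φ P) = (red P).map φ := by
  rw [red, red, Polynomial.map_map, Polynomial.map_map]
  congr 1
  ext a <;> simp

/-- The base-change map `R_A = A[z]/(P₀) → R_B = B[z]/(φP₀)`, `z̄ ↦ z̄`. [folklore] -/
def spec : Rt P →+* Rt (mapP φ P) :=
  AdjoinRoot.map φ (red P) (red (mapP φ P)) (by rw [red_mapP])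

end Functorial

/-! ### Evaluation at the roots of `P(x, 0)` -/

section Roots

variable {K : Type u} [Field K] {L : Type v} [Field L] [Algebra K L]

/-- The evaluation `R = K[z]/(P₀) → L` at a root `ζ ∈ L` of `P₀` (Kaltofen: "specialize `z` to a
root `ζ` of `f₀`"). [cite: Kaltofen1995, §3 (after eq. (7))] -/
abbrev evRoot (P : Polynomial K[X]) (ζ : (red P).rootSet L) : Rt P →+* L :=
  AdjoinRoot.lift (algebraMap K L) (ζ : L)
    (by have := aeval_eq_zero_of_mem_rootSet ζ.2; rwa [aeval_def] at this)

end Roots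

/-! ### The generic polynomial and the integer forms `Δ` -/

section Generic

/-- The generic coefficient ring `E = ℤ[…, c_{e₁,e₂}, …]` (one variable for every pair; only
those with `e₁ < d`, `e₁ + e₂ ≤ d` are used). [cite: Kaltofen1995, §3 ("`D := ℤ[…, c_{e₁,e₂}, …]`")] -/
abbrev GenCoeff : Type := MvPolynomial (ℕ × ℕ) ℤ

/-- The exponent pairs `(e₁, e₂)` of the generic polynomial of degree `d`: `e₁ < d`,
`e₁ + e₂ ≤ d`. [folklore] -/
def genSupport (d : ℕ) : Finset (ℕ × ℕ) :=
  (Finset.range d ×ˢ Finset.range (d + 1)).filter fun p => p.1 + p.2 ≤ d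

/-- Membership in `genSupport`. [folklore] -/
theorem mem_genSupport {d : ℕ} {p : ℕ × ℕ} : p ∈ genSupport d ↔ p.1 < d ∧ p.1 + p.2 ≤ d := by
  simp only [genSupport, Finset.mem_filter, Finset.mem_product, Finset.mem_range]
  constructor
  · rintro ⟨⟨h1, -⟩, h2⟩; exact ⟨h1, h2⟩
  · rintro ⟨h1, h2⟩; exact ⟨⟨h1, by omega⟩, h2⟩

/-- Kaltofen's generic monic polynomial `f = x^d + Σ_{e₁<d, e₁+e₂≤d} c_{e₁,e₂} x^{e₁} y^{e₂}` over
`E`, in `E[y][x]`. [cite: Kaltofen1995, §3 (before Lemma 1)] -/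
def genPoly (d : ℕ) : Polynomial (Polynomial GenCoeff) :=
  X ^ d + ∑ p ∈ genSupport d, C (C (MvPolynomial.X p) * X ^ p.2) * X ^ p.1

/-- The specialisation `E → K` at a coefficient vector `q` (integer coefficients are read in
`K`, i.e. modulo the characteristic). [cite: Kaltofen1995, Thm. 7 ("taken modulo this characteristic")] -/
abbrev specialize {K : Type u} [CommRing K] (q : ℕ × ℕ → K) : GenCoeff →+* K :=
  MvPolynomial.eval₂Hom (Int.castRingHom K) q

/-- The coefficient vector of `f ∈ K[y][x]`: `q(e₁, e₂) = ` coefficient of `x^{e₁} y^{e₂}`.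
[folklore] -/
abbrev coeffVec {K : Type u} [CommRing K] (f : Polynomial K[X]) : ℕ × ℕ → K :=
  fun p => (f.coeff p.1).coeff p.2

/-- The generic polynomial is monic of degree `d` in `x`. [folklore] -/
theorem genPoly_natDegree_and_monic (d : ℕ) : (genPoly d).natDegree = d ∧ (genPoly d).Monic := by
  have hlt : ∀ p ∈ genSupport d, (C (C (MvPolynomial.X p) * X ^ p.2) * X ^ p.1 :
      Polynomial (Polynomial GenCoeff)).degree < d := by
    intro p hp
    refine (degree_C_mul_X_pow_le _ _).trans_lt ?_
    exact_mod_cast (mem_genSupport.1 hp).1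
  have hsum : (∑ p ∈ genSupport d, C (C (MvPolynomial.X p) * X ^ p.2) * X ^ p.1 :
      Polynomial (Polynomial GenCoeff)).degree < d :=
    (degree_sum_le _ _).trans_lt ((Finset.sup_lt_iff (WithBot.bot_lt_coe d)).2 hlt)
  have hmo : (genPoly d).Monic := by
    rw [genPoly]
    exact (monic_X_pow d).add_of_left (by rwa [degree_X_pow])
  refine ⟨?_, hmo⟩
  rw [genPoly, natDegree_add_eq_left_of_degree_lt (by rwa [degree_X_pow]), natDegree_X_pow]

/-- `P(x,0)` of the generic polynomial is monic. [folklore] -/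
theorem red_genPoly_monic (d : ℕ) : (red (genPoly d)).Monic :=
  (genPoly_natDegree_and_monic d).2.map _

/-- **Kaltofen's Noether-form ingredients `Δ_S ∈ ℤ[c]`:** the maximal minors of the matrix (29) of
the generic polynomial (unknown `y`-degrees `≤ d`, precision `ℓ = (2d-1)d`, root precision
`2ℓ + 1`), indexed by the choice `S` of `N = d²(d+1)` rows. [cite: Kaltofen1995, §3 Thm. 4, §5 Thm. 7 (the `Δ`)] -/
def genMinor (d : ℕ) (S : Fin d × Fin (d + 1) × Fin d → Fin ((2 * d - 1) * d + 1) × Fin d) : GenCoeff :=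
  ((kMatrix (genPoly d) d d (2 * ((2 * d - 1) * d) + 1) (red_genPoly_monic d) ((2 * d - 1) * d)).submatrix
    S id).det

end Generic

end Literature.RingTheory.MvPolynomial.KaltofenAIT

end
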